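import Summits.NavierStokesRegularity.NavierStokesRegularity.Theorems.TypeICertificateLadderTargetRotatingConjugateDensityDecay
import Literature.Analysis.FluidPDE.PineauVicolRSSProofs
import HarnessLib

/-!
# The two-sided Gaussian bounds for the rotating conjugate density
# (tools for stub B2 of line `killing-twisted-bernoulli-solitons`, crux `Target`, stmt-NavierStokesRegularity-1217)

Helper file (all results proved, no definitions, no named facts). Rotating-gauge version of the
upper and lower Gaussian bounds (5.3) of Pineau–Vicol 2026, Prop. 5.1 (Lemmas 5.4–5.5,
arXiv:2607.09619; tree: `DriftHyp.upper_bound`, `DriftHyp.lower_bound` in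
`PineauVicolWeightBounds`), for a positive smooth solution `v` of `N v = 0` with the drift
`½y + (U − J)`, `DriftHyp U C₀`, `J` skew linear with `‖J‖ ≤ A`:

* `upper_bound_rot`: `v(y) e^{−ε|y|²/4} ≤ (max C_H 1)^N e^{(1−ε)R_ε²/4} v(0)`;
* `lower_bound_rot`: `v(0) (max C_H 1)^{−N'} e^{−ε|y|²/2} ≤ v(y) e^{−ε|y|²/4}`,

with the SAME radii `R_ε = upperRadius`, `R'_ε = barrierRadius` as in the tree (they come from the
potential/forcing signs, which see only `⟪U′y, y⟫ = ⟪Uy, y⟫ ≥ −C₀`) and the Harnack-chain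
exponents `N = ⌈R(C₀ + (½ + A)(R + 2) + 5)⌉ + 1` (the chain sees the drift bound
`sup_{B(0,R+2)} |U′ + ½y| ≤ C₀ + (½ + A)(R + 2)`), so that all constants depend on
`ε, C₀, A` and the dimension only. The comparison on annuli (`weak_maximum_principle`,
`barrier_equation`, `barrier_gaussian`, `decay_rot`) is verbatim the tree's.

References: B. Pineau, V. Vicol, arXiv:2607.09619 (2026), Prop. 5.1, (5.3), Lemmas 5.4–5.6,
(5.6)–(5.10).
-/

noncomputable section

open MeasureTheory TopologicalSpace Set Function Filter Topology InnerProductSpace Real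
open scoped RealInnerProductSpace ENNReal NNReal ContDiff Distributions

namespace Summit.NavierStokesRegularity.NavierStokesRegularity.Theorems

open Literature.Analysis.FluidPDE Literature.Analysis.FluidPDE.PineauVicol2026
open scoped Laplacian

variable {E : Type} [NormedAddCommGroup E] [InnerProductSpace ℝ E] [FiniteDimensional ℝ E]
  [MeasurableSpace E] [BorelSpace E]

variable {U : E → E} {C₀ : ℝ}

/-- **Harnack chain bound on `B̄(0, R)`, rotating gauge**: for `w = γ v`, `v > 0`, `N v = 0`,
`‖J‖ ≤ A`: `w z ≤ K w 0` and `w 0 ≤ K w z` on `B̄(0,R)` with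
`K = (max C_H 1)^{⌈R(C₀ + (½ + A)(R+2) + 5)⌉+1}`. [folklore] -/
theorem harnack_chain_rot (h : DriftHyp U C₀) {J : E →L[ℝ] E} (hJ : ∀ v, ⟪J v, v⟫ = 0) {A : ℝ}
    (hA0 : 0 ≤ A) (hA : ‖J‖ ≤ A) {v : E → ℝ} (hv : ContDiff ℝ ∞ v) (hvpos : ∀ y, 0 < v y)
    (hN : ∀ y, adjN (fun z : E => (1 / 2 : ℝ) • z + (U z - J z)) v y = 0) {R : ℝ} (hR : 0 ≤ R)
    {z : E} (hz : z ∈ Metric.closedBall (0 : E) R) :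
    gaussWeight z * v z ≤ (max (harnackConst E) 1) ^ (⌈R * (C₀ + (1 / 2 + A) * (R + 2) + 5)⌉₊ + 1) * v 0 ∧
      v 0 ≤ (max (harnackConst E) 1) ^ (⌈R * (C₀ + (1 / 2 + A) * (R + 2) + 5)⌉₊ + 1) * (gaussWeight z * v z) := by
  haveI : CompleteSpace E := FiniteDimensional.complete ℝ E
  set n := Module.finrank ℝ E with hn
  have hC₀ := h.nonneg
  set Cm := max (harnackConst E) 1 with hCm
  have hCm1 : 1 ≤ Cm := le_max_right _ _
  set N : ℕ := ⌈R * (C₀ + (1 / 2 + A) * (R + 2) + 5)⌉₊ + 1 with hNdef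
  set w : E → ℝ := fun z => gaussWeight z * v z with hw
  have hws : ContDiff ℝ ∞ w := contDiff_gaussWeight.mul hv
  have hwpos : ∀ x, 0 < w x := fun x => mul_pos (gaussWeight_pos x) (hvpos x)
  have hweq : ∀ x, (Δ w) x + fderiv ℝ w x ((U x - J x) + (1 / 2 : ℝ) • x) + n / 2 * w x = 0 :=
    w_equation_rot h hJ (hv.of_le (by norm_cast)) hN
  have hβ : Continuous fun x : E => (U x - J x) + (1 / 2 : ℝ) • x :=
    (h.continuous.sub J.continuous).add (continuous_id.const_smul _)
  have hw0 : w 0 = v 0 := by simp [hw, gaussWeight]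
  have hzR : ‖z‖ ≤ R := by simpa [Metric.mem_closedBall, dist_zero_right] using hz
  have hCN : (1 : ℝ) ≤ Cm ^ N := one_le_pow₀ hCm1
  show w z ≤ Cm ^ N * v 0 ∧ v 0 ≤ Cm ^ N * w z
  rcases hR.eq_or_lt with h0 | hRpos
  · have : z = 0 := by rw [← norm_le_zero_iff]; exact hzR.trans_eq h0.symm
    subst this
    rw [hw0]
    constructor <;> nlinarith [hvpos 0]
  · have hAbd : ∀ x ∈ Metric.ball (0 : E) (R + 2), ‖(U x - J x) + (1 / 2 : ℝ) • x‖ ≤ C₀ + (1 / 2 + A) * (R + 2) := by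
      intro x hx
      rw [Metric.mem_ball, dist_zero_right] at hx
      calc ‖(U x - J x) + (1 / 2 : ℝ) • x‖ ≤ ‖U x - J x‖ + ‖(1 / 2 : ℝ) • x‖ := norm_add_le _ _
        _ ≤ (C₀ + ‖J‖ * ‖x‖) + (1 / 2) * ‖x‖ := by
            rw [norm_smul, Real.norm_eq_abs, abs_of_pos (by norm_num : (0:ℝ) < 1 / 2)]
            exact add_le_add (norm_sub_skew_le h J x) le_rfl
        _ ≤ C₀ + (1 / 2 + A) * (R + 2) := by
            have : ‖J‖ * ‖x‖ ≤ A * (R + 2) := mul_le_mul hA hx.le (norm_nonneg _) hA0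
            nlinarith
    have hch := harnack_chain hws hwpos hβ (by positivity : (0 : ℝ) ≤ n / 2) hweq hRpos (by positivity) hAbd hz
    rw [← hCm, hw0] at hch
    exact hch

/-- **Upper Gaussian bound, rotating gauge** (Pineau–Vicol (5.3), upper half, for the drift
`½y + (U − J)`, `‖J‖ ≤ A`): for a positive smooth solution `v ∈ L²(γ)` of `N v = 0` and
`ε ∈ (½, 1)`, `v(y) e^{−ε|y|²/4} ≤ (max C_H 1)^N e^{(1−ε)R_ε²/4} v(0)` with
`N = ⌈R_ε(C₀ + (½ + A)(R_ε + 2) + 5)⌉ + 1`, `R_ε = upperRadius n C₀ ε`. [cite: PineauVicol2026, Lemma 5.4 and (5.3)] -/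
theorem upper_bound_rot (h : DriftHyp U C₀) {J : E →L[ℝ] E} (hJ : ∀ v, ⟪J v, v⟫ = 0) {A : ℝ}
    (hA0 : 0 ≤ A) (hA : ‖J‖ ≤ A) {v : E → ℝ} (hv : ContDiff ℝ ∞ v)
    (hvpos : ∀ y, 0 < v y) (hv2 : MemLp v 2 (gaussMeasure (E := E)))
    (hN : ∀ y, adjN (fun z : E => (1 / 2 : ℝ) • z + (U z - J z)) v y = 0) {ε : ℝ} (hε : 1 / 2 < ε) (hε1 : ε < 1)
    {e : E} (he : ‖e‖ = 1) (y : E) :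
    v y * gaussProfile (-(ε / 4)) y ≤
      (max (harnackConst E) 1) ^ (⌈upperRadius (Module.finrank ℝ E) C₀ ε *
          (C₀ + (1 / 2 + A) * (upperRadius (Module.finrank ℝ E) C₀ ε + 2) + 5)⌉₊ + 1) *
        Real.exp ((1 - ε) * (upperRadius (Module.finrank ℝ E) C₀ ε) ^ 2 / 4) * v 0 := by
  haveI : CompleteSpace E := FiniteDimensional.complete ℝ E
  set n := Module.finrank ℝ E with hn
  set Rε := upperRadius n C₀ ε with hRε
  have hRε0 : 0 ≤ Rε := Real.sqrt_nonneg _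
  have hC₀ := h.nonneg
  set Cm := max (harnackConst E) 1 with hCm
  have hCm1 : 1 ≤ Cm := le_max_right _ _
  set N : ℕ := ⌈Rε * (C₀ + (1 / 2 + A) * (Rε + 2) + 5)⌉₊ + 1 with hNdef
  set M : ℝ := Cm ^ N * Real.exp ((1 - ε) * Rε ^ 2 / 4) * v 0 with hM
  have hv0 := hvpos 0
  have hMpos : 0 < M := by positivity
  have hin : ∀ x, ⟪U x - J x, x⟫ = ⟪U x, x⟫ := inner_sub_skew_eq U hJ
  set w : E → ℝ := fun z => gaussWeight z * v z with hw
  have hwpos : ∀ x, 0 < w x := fun x => mul_pos (gaussWeight_pos x) (hvpos x)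
  have hball : ∀ z ∈ Metric.closedBall (0 : E) Rε, v z * gaussProfile (-(ε / 4)) z ≤ M := by
    intro z hz
    have hzR : ‖z‖ ≤ Rε := by simpa [Metric.mem_closedBall, dist_zero_right] using hz
    rw [phiEps_eq]
    have hchain : w z ≤ Cm ^ N * v 0 := (harnack_chain_rot h hJ hA0 hA hv hvpos hN hRε0 hz).1
    have hexp : Real.exp ((1 - ε) * ‖z‖ ^ 2 / 4) ≤ Real.exp ((1 - ε) * Rε ^ 2 / 4) := by
      apply Real.exp_le_exp.2
      have : ‖z‖ ^ 2 ≤ Rε ^ 2 := pow_le_pow_left₀ (norm_nonneg _) hzR 2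
      have : 0 ≤ 1 - ε := by linarith
      nlinarith
    show w z * Real.exp ((1 - ε) * ‖z‖ ^ 2 / 4) ≤ M
    calc w z * Real.exp ((1 - ε) * ‖z‖ ^ 2 / 4) ≤ Cm ^ N * v 0 * Real.exp ((1 - ε) * Rε ^ 2 / 4) :=
          mul_le_mul hchain hexp (Real.exp_pos _).le
            (mul_nonneg (le_trans zero_le_one (one_le_pow₀ hCm1)) hv0.le)
      _ = M := by rw [hM]; ring
  -- outside the ball: maximum principle on an annulus
  by_cases hyR : ‖y‖ ≤ Rε
  · exact hball y (by simpa [Metric.mem_closedBall, dist_zero_right] using hyR)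
  push Not at hyR
  obtain ⟨R₀, hR₀⟩ := decay_rot h hJ hv hvpos hv2 hN hε hMpos
  set R : ℝ := max R₀ (‖y‖ + 1) with hRdef
  have hyRlt : ‖y‖ < R := by rw [hRdef]; exact lt_of_lt_of_le (by linarith) (le_max_right _ _)
  have hRpos : 0 < R := (norm_nonneg y).trans_lt hyRlt
  set D : Set E := {z : E | Rε < ‖z‖ ∧ ‖z‖ < R} with hDdef
  have hDopen : IsOpen D :=
    (isOpen_lt continuous_const continuous_norm).inter (isOpen_lt continuous_norm continuous_const)
  have hDbdd : Bornology.IsBounded D := by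
    refine (Metric.isBounded_closedBall (x := (0 : E)) (r := R)).subset fun z hz => ?_
    rw [Metric.mem_closedBall, dist_zero_right]; exact hz.2.le
  set φ : E → ℝ := fun z => v z * gaussProfile (-(ε / 4)) z with hφdef
  have hφs : ContDiff ℝ 2 φ := (hv.of_le (by norm_cast)).mul (contDiff_gaussProfile _)
  have hvM := v_equation_rot h hJ (hv.of_le (by norm_cast)) hN
  -- WMP data
  have hb : ∀ x ∈ D, ‖(U x - J x) + (ε - 1 / 2) • x‖ ≤ C₀ + (A + 1) * R := by
    intro x hx
    calc ‖(U x - J x) + (ε - 1 / 2) • x‖ ≤ ‖U x - J x‖ + ‖(ε - 1 / 2) • x‖ := norm_add_le _ _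
      _ ≤ C₀ + (A + 1) * R := by
          rw [norm_smul, Real.norm_eq_abs, abs_of_pos (by linarith : (0:ℝ) < ε - 1 / 2)]
          have h1 : (ε - 1 / 2) * ‖x‖ ≤ 1 * R := mul_le_mul (by linarith) hx.2.le (norm_nonneg _) zero_le_one
          have h2 : ‖J‖ * ‖x‖ ≤ A * R := mul_le_mul hA hx.2.le (norm_nonneg _) hA0
          linarith [norm_sub_skew_le h J x]
  have hV : ∀ x ∈ D, 0 ≤ ε * (1 - ε) * ‖x‖ ^ 2 / 4 - n * ε / 2 + (1 - ε) * ⟪U x - J x, x⟫ / 2 := fun x hx => by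
    rw [hin x]; exact h.potential_nonneg (by linarith) hε1 hx.1.le
  have hV₀ : ∀ x ∈ D, ε * (1 - ε) * ‖x‖ ^ 2 / 4 - n * ε / 2 + (1 - ε) * ⟪U x - J x, x⟫ / 2 ≤
      ε * (1 - ε) * R ^ 2 / 4 + (1 - ε) * C₀ / 2 := by
    intro x hx
    rw [hin x]
    have h1 : ‖x‖ ^ 2 ≤ R ^ 2 := pow_le_pow_left₀ (norm_nonneg _) hx.2.le 2
    have h2 : ⟪U x, x⟫ ≤ C₀ := (abs_le.1 (h.abs_inner_le x)).2
    have h3 : 0 < ε * (1 - ε) := mul_pos (by linarith) (by linarith)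
    have h4 : (0 : ℝ) ≤ n * ε / 2 := by positivity
    nlinarith
  have hsub : ∀ x ∈ D, -(Δ φ) x - fderiv ℝ φ x ((U x - J x) + (ε - 1 / 2) • x) +
      (ε * (1 - ε) * ‖x‖ ^ 2 / 4 - n * ε / 2 + (1 - ε) * ⟪U x - J x, x⟫ / 2) * φ x ≤ 0 := fun x _ =>
    (barrier_equation (U := fun z => U z - J z) (hv.of_le (by norm_cast)) hvM ε hφdef x).le
  have hbdry : ∀ x ∈ frontier D, φ x ≤ M := by
    intro x hx
    rcases frontier_annulus_subset Rε R hx with hxe | hxe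
    · exact hball x (by simp [Metric.mem_closedBall, dist_zero_right, hxe])
    · exact hR₀ x (by rw [hxe]; exact le_max_left _ _)
  have hV₀0 : 0 ≤ ε * (1 - ε) * R ^ 2 / 4 + (1 - ε) * C₀ / 2 := by
    have : 0 < ε * (1 - ε) := mul_pos (by linarith) (by linarith)
    have : 0 ≤ 1 - ε := by linarith
    positivity
  have key := weak_maximum_principle hDopen hDbdd he hφs (by positivity : (0:ℝ) ≤ C₀ + (A + 1) * R) hV₀0 hb hV hV₀ hsub
    hMpos.le hbdry y (subset_closure ⟨hyR, hyRlt⟩)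
  simpa only [hφdef] using key

/-- **Lower Gaussian bound, rotating gauge** (Pineau–Vicol (5.3), lower half, drift
`½y + (U − J)`, `‖J‖ ≤ A`): `v(0) (max C_H 1)^{−N'} e^{−ε|y|²/2} ≤ v(y) e^{−ε|y|²/4}` with
`N' = ⌈R'(C₀ + (½ + A)(R' + 2) + 5)⌉ + 1`, `R' = barrierRadius n C₀ ε`. [cite: PineauVicol2026, Lemma 5.5 and (5.3)] -/
theorem lower_bound_rot (h : DriftHyp U C₀) {J : E →L[ℝ] E} (hJ : ∀ v, ⟪J v, v⟫ = 0) {A : ℝ}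
    (hA0 : 0 ≤ A) (hA : ‖J‖ ≤ A) {v : E → ℝ} (hv : ContDiff ℝ ∞ v) (hvpos : ∀ y, 0 < v y)
    (hN : ∀ y, adjN (fun z : E => (1 / 2 : ℝ) • z + (U z - J z)) v y = 0) {ε : ℝ} (hε : 1 / 2 < ε) (hε1 : ε < 1)
    {e : E} (he : ‖e‖ = 1) (y : E) :
    v 0 / (max (harnackConst E) 1) ^ (⌈barrierRadius (Module.finrank ℝ E) C₀ ε *
          (C₀ + (1 / 2 + A) * (barrierRadius (Module.finrank ℝ E) C₀ ε + 2) + 5)⌉₊ + 1) * gaussProfile (-(ε / 2)) y ≤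
      v y * gaussProfile (-(ε / 4)) y := by
  haveI : CompleteSpace E := FiniteDimensional.complete ℝ E
  set n := Module.finrank ℝ E with hn
  set R' := barrierRadius n C₀ ε with hR'
  have hR'0 : 0 ≤ R' := le_max_of_le_left (Real.sqrt_nonneg _)
  have hC₀ := h.nonneg
  set Cm := max (harnackConst E) 1 with hCm
  have hCm1 : 1 ≤ Cm := le_max_right _ _
  set N : ℕ := ⌈R' * (C₀ + (1 / 2 + A) * (R' + 2) + 5)⌉₊ + 1 with hNdef
  have hv0 := hvpos 0
  have hCN : 1 ≤ Cm ^ N := one_le_pow₀ hCm1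
  have hCNpos : 0 < Cm ^ N := by positivity
  have hin : ∀ x, ⟪U x - J x, x⟫ = ⟪U x, x⟫ := inner_sub_skew_eq U hJ
  set m : ℝ := v 0 / Cm ^ N with hm
  have hmpos : 0 < m := div_pos hv0 hCNpos
  -- the chain bound on `B̄(0, R')`
  set w : E → ℝ := fun z => gaussWeight z * v z with hw
  have hwpos : ∀ x, 0 < w x := fun x => mul_pos (gaussWeight_pos x) (hvpos x)
  have hballw : ∀ z ∈ Metric.closedBall (0 : E) R', m ≤ w z := by
    intro z hz
    have := (harnack_chain_rot h hJ hA0 hA hv hvpos hN hR'0 hz).2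
    rw [hm, div_le_iff₀ hCNpos]
    show v 0 ≤ gaussWeight z * v z * Cm ^ N
    linarith
  clear_value m
  set φ : E → ℝ := fun z => v z * gaussProfile (-(ε / 4)) z with hφdef
  have hφs : ContDiff ℝ 2 φ := (hv.of_le (by norm_cast)).mul (contDiff_gaussProfile _)
  have hφpos : ∀ z, 0 < φ z := fun z => mul_pos (hvpos z) (Real.exp_pos _)
  have hg1 : ∀ z : E, gaussProfile (-(ε / 2)) z ≤ 1 := fun z => by
    rw [gaussProfile]; apply Real.exp_le_one_iff.2; nlinarith [sq_nonneg ‖z‖]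
  have hgpos : ∀ z : E, 0 < gaussProfile (-(ε / 2)) z := fun z => Real.exp_pos _
  have hball : ∀ z ∈ Metric.closedBall (0 : E) R', m * gaussProfile (-(ε / 2)) z ≤ φ z := by
    intro z hz
    have h1 : m * gaussProfile (-(ε / 2)) z ≤ m := by nlinarith [hg1 z, hgpos z]
    have h2 : w z ≤ φ z := by
      show w z ≤ v z * gaussProfile (-(ε / 4)) z
      rw [phiEps_eq]
      have : 1 ≤ Real.exp ((1 - ε) * ‖z‖ ^ 2 / 4) := Real.one_le_exp (by
        have : 0 ≤ 1 - ε := by linarith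
        positivity)
      show w z ≤ w z * Real.exp ((1 - ε) * ‖z‖ ^ 2 / 4)
      nlinarith [hwpos z]
    linarith [hballw z hz]
  -- suppose the bound fails at `y`
  show m * gaussProfile (-(ε / 2)) y ≤ φ y
  by_contra hlt
  push Not at hlt
  have hyR : R' < ‖y‖ := by
    by_contra hle
    push Not at hle
    exact absurd (hball y (by simpa [Metric.mem_closedBall, dist_zero_right] using hle)) (not_le.2 hlt)
  set δ : ℝ := m * gaussProfile (-(ε / 2)) y - φ y with hδ
  have hδpos : 0 < δ := by rw [hδ]; linarith
  clear_value δ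
  obtain ⟨R₂, hR₂0, hR₂⟩ := exists_exp_quadratic_le (a := ε / 2) (by linarith) 0 0 (η := δ / (2 * m)) (by positivity)
  set R : ℝ := max R₂ (‖y‖ + 1) with hRdef
  have hyRlt : ‖y‖ < R := lt_of_lt_of_le (by linarith) (le_max_right _ _)
  have hRpos : 0 < R := (norm_nonneg y).trans_lt hyRlt
  have hR₂R : R₂ ≤ R := le_max_left _ _
  clear_value R
  set M₀ : ℝ := m * Real.exp (-(ε / 2) * R ^ 2) with hM₀
  have hM₀0 : 0 ≤ M₀ := by rw [hM₀]; exact mul_nonneg hmpos.le (Real.exp_pos _).le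
  clear_value M₀
  have hM₀δ : M₀ ≤ δ / 2 := by
    have := hR₂ R hR₂R
    simp only [zero_mul, add_zero] at this
    rw [hM₀]
    calc m * Real.exp (-(ε / 2) * R ^ 2) ≤ m * (δ / (2 * m)) := mul_le_mul_of_nonneg_left this hmpos.le
      _ = δ / 2 := by field_simp
  -- the annulus and the WMP data
  set D : Set E := {z : E | R' < ‖z‖ ∧ ‖z‖ < R} with hDdef
  have hDopen : IsOpen D :=
    (isOpen_lt continuous_const continuous_norm).inter (isOpen_lt continuous_norm continuous_const)
  have hDbdd : Bornology.IsBounded D := by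
    refine (Metric.isBounded_closedBall (x := (0 : E)) (r := R)).subset fun z hz => ?_
    rw [Metric.mem_closedBall, dist_zero_right]; exact hz.2.le
  have hvM := v_equation_rot h hJ (hv.of_le (by norm_cast)) hN
  set ψ : E → ℝ := m • gaussProfile (E := E) (-(ε / 2)) - φ with hψdef
  clear_value ψ
  have hψapp : ∀ z, ψ z = m * gaussProfile (-(ε / 2)) z - φ z := fun z => by simp [hψdef]
  have hgs : ContDiff ℝ 2 (gaussProfile (E := E) (-(ε / 2))) := contDiff_gaussProfile _
  have hmgs : ContDiff ℝ 2 (m • gaussProfile (E := E) (-(ε / 2))) := by exact hgs.const_smul m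
  have hψs : ContDiff ℝ 2 ψ := by rw [hψdef]; exact hmgs.sub hφs
  have hb : ∀ x ∈ D, ‖(U x - J x) + (ε - 1 / 2) • x‖ ≤ C₀ + (A + 1) * R := by
    intro x hx
    calc ‖(U x - J x) + (ε - 1 / 2) • x‖ ≤ ‖U x - J x‖ + ‖(ε - 1 / 2) • x‖ := norm_add_le _ _
      _ ≤ C₀ + (A + 1) * R := by
          rw [norm_smul, Real.norm_eq_abs, abs_of_pos (by linarith : (0:ℝ) < ε - 1 / 2)]
          have h1 : (ε - 1 / 2) * ‖x‖ ≤ 1 * R := mul_le_mul (by linarith) hx.2.le (norm_nonneg _) zero_le_one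
          have h2 : ‖J‖ * ‖x‖ ≤ A * R := mul_le_mul hA hx.2.le (norm_nonneg _) hA0
          linarith [norm_sub_skew_le h J x]
  have hR'u : upperRadius n C₀ ε ≤ R' := le_max_left _ _
  have hR'l : lowerRadius n C₀ ε ≤ R' := le_max_right _ _
  have hV : ∀ x ∈ D, 0 ≤ ε * (1 - ε) * ‖x‖ ^ 2 / 4 - n * ε / 2 + (1 - ε) * ⟪U x - J x, x⟫ / 2 := fun x hx => by
    rw [hin x]; exact h.potential_nonneg (by linarith) hε1 (hR'u.trans hx.1.le)
  have hV₀ : ∀ x ∈ D, ε * (1 - ε) * ‖x‖ ^ 2 / 4 - n * ε / 2 + (1 - ε) * ⟪U x - J x, x⟫ / 2 ≤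
      ε * (1 - ε) * R ^ 2 / 4 + (1 - ε) * C₀ / 2 := by
    intro x hx
    rw [hin x]
    have h1 : ‖x‖ ^ 2 ≤ R ^ 2 := pow_le_pow_left₀ (norm_nonneg _) hx.2.le 2
    have h2 : ⟪U x, x⟫ ≤ C₀ := (abs_le.1 (h.abs_inner_le x)).2
    have h3 : 0 < ε * (1 - ε) := mul_pos (by linarith) (by linarith)
    have h4 : (0 : ℝ) ≤ n * ε / 2 := by positivity
    nlinarith
  have hV₀0 : 0 ≤ ε * (1 - ε) * R ^ 2 / 4 + (1 - ε) * C₀ / 2 := by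
    have : 0 < ε * (1 - ε) := mul_pos (by linarith) (by linarith)
    have : 0 ≤ 1 - ε := by linarith
    positivity
  have hsub : ∀ x ∈ D, -(Δ ψ) x - fderiv ℝ ψ x ((U x - J x) + (ε - 1 / 2) • x) +
      (ε * (1 - ε) * ‖x‖ ^ 2 / 4 - n * ε / 2 + (1 - ε) * ⟪U x - J x, x⟫ / 2) * ψ x ≤ 0 := by
    intro x hx
    have hF := h.forcing_nonneg (by linarith : (0:ℝ) < ε) (hR'l.trans hx.1.le)
    have e1 := barrier_gaussian (fun z => U z - J z) ε x
    have e2 := barrier_equation (U := fun z => U z - J z) (hv.of_le (by norm_cast)) hvM ε hφdef x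
    have hΔ : (Δ ψ) x = m * (Δ (gaussProfile (E := E) (-(ε / 2)))) x - (Δ φ) x := by
      rw [hψdef, ContDiffAt.laplacian_sub (f₁ := m • gaussProfile (E := E) (-(ε / 2))) hmgs.contDiffAt hφs.contDiffAt,
        laplacian_smul _ hgs.contDiffAt, smul_eq_mul]
    have hmgd : DifferentiableAt ℝ (m • gaussProfile (E := E) (-(ε / 2))) x := hmgs.differentiable (by norm_num) x
    have hDψ : fderiv ℝ ψ x = m • fderiv ℝ (gaussProfile (E := E) (-(ε / 2))) x - fderiv ℝ φ x := by
      rw [hψdef, fderiv_sub hmgd (hφs.differentiable (by norm_num) x),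
        fderiv_const_smul (hgs.differentiable (by norm_num) x)]
    rw [hΔ, hDψ, hψapp x]
    simp only [_root_.sub_apply, FunLike.coe_smul, Pi.smul_apply, smul_eq_mul]
    have hg0 := (hgpos x).le
    have key : -(m * (Δ (gaussProfile (E := E) (-(ε / 2)))) x - (Δ φ) x) -
        (m * fderiv ℝ (gaussProfile (E := E) (-(ε / 2))) x ((U x - J x) + (ε - 1 / 2) • x) -
          fderiv ℝ φ x ((U x - J x) + (ε - 1 / 2) • x)) +
        (ε * (1 - ε) * ‖x‖ ^ 2 / 4 - n * ε / 2 + (1 - ε) * ⟪U x - J x, x⟫ / 2) * (m * gaussProfile (-(ε / 2)) x - φ x) =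
        m * (-(gaussProfile (-(ε / 2)) x * (ε * (1 + ε) * ‖x‖ ^ 2 / 4 - (1 + ε) * ⟪U x - J x, x⟫ / 2 - n * ε / 2))) - 0 := by
      rw [← e1, ← e2]; ring
    rw [key, sub_zero, mul_neg, neg_nonpos, hin x]
    exact mul_nonneg hmpos.le (mul_nonneg hg0 hF)
  have hbdry : ∀ x ∈ frontier D, ψ x ≤ M₀ := by
    intro x hx
    rw [hψapp]
    rcases frontier_annulus_subset R' R hx with hxe | hxe
    · have := hball x (by simp [Metric.mem_closedBall, dist_zero_right, hxe])
      linarith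
    · have : m * gaussProfile (-(ε / 2)) x = M₀ := by rw [hM₀, gaussProfile, hxe]
      linarith [hφpos x]
  have key := weak_maximum_principle hDopen hDbdd he hψs (by positivity : (0:ℝ) ≤ C₀ + (A + 1) * R) hV₀0 hb hV hV₀ hsub
    hM₀0 hbdry y (subset_closure ⟨hyR, hyRlt⟩)
  rw [hψapp] at key
  linarith

/-- **Registered form (B2 tool stub `rotatingDensity_gaussianBounds`, `ℝ³`, `J = α • rotGenL`,
`|α| ≤ A`):** the two-sided bounds (5.3) with constants depending on `ε, C₀, A` only. [cite: PineauVicol2026, Prop. 5.1, (5.3)] -/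
theorem rotatingDensity_gaussianBounds :
    ∀ (U : EuclideanSpace ℝ (Fin 3) → EuclideanSpace ℝ (Fin 3)) (C₀ α A : ℝ), Literature.Analysis.FluidPDE.PineauVicol2026.DriftHyp U C₀ → 0 ≤ A → |α| ≤ A → ∀ v : EuclideanSpace ℝ (Fin 3) → ℝ, ContDiff ℝ (⊤ : ℕ∞) v → (∀ y, 0 < v y) → MeasureTheory.MemLp v 2 (Literature.Analysis.FluidPDE.PineauVicol2026.gaussMeasure (E := EuclideanSpace ℝ (Fin 3))) → (∀ y : EuclideanSpace ℝ (Fin 3), Literature.Analysis.FluidPDE.PineauVicol2026.adjN (fun z => (1 / 2 : ℝ) • z + (U z - α • Literature.Analysis.FluidPDE.rotGen z)) v y = 0) → ∀ ε : ℝ, 1 / 2 < ε → ε < 1 → ∀ y : EuclideanSpace ℝ (Fin 3), v y * Literature.Analysis.FluidPDE.gaussProfile (-(ε / 4)) y ≤ (max (Literature.Analysis.FluidPDE.PineauVicol2026.harnackConst (EuclideanSpace ℝ (Fin 3))) 1) ^ (⌈Literature.Analysis.FluidPDE.PineauVicol2026.upperRadius (Module.finrank ℝ (EuclideanSpace ℝ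 (Fin 3))) C₀ ε * (C₀ + (1 / 2 + A) * (Literature.Analysis.FluidPDE.PineauVicol2026.upperRadius (Module.finrank ℝ (EuclideanSpace ℝ (Fin 3))) C₀ ε + 2) + 5)⌉₊ + 1) * Real.exp ((1 - ε) * (Literature.Analysis.FluidPDE.PineauVicol2026.upperRadius (Module.finrank ℝ (EuclideanSpace ℝ (Fin 3))) C₀ ε) ^ 2 / 4) * v 0 ∧ v 0 / (max (Literature.Analysis.FluidPDE.PineauVicol2026.harnackConst (EuclideanSpace ℝ (Fin 3))) 1) ^ (⌈Literature.Analysis.FluidPDE.PineauVicol2026.barrierRadius (Module.finrank ℝ (EuclideanSpace ℝ (Fin 3))) C₀ ε * (C₀ + (1 / 2 + A) * (Literature.Analysis.FluidPDE.PineauVicol2026.barrierRadius (Module.finrank ℝ (EuclideanSpace ℝ (Fin 3))) C₀ ε + 2) + 5)⌉₊ + 1) * Literature.Analysis.FluidPDE.gaussProfile (-(ε / 2)) y ≤ v y * Literature.Analysis.FluidPDE.gaussProfile (-(ε / 4)) y := by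
  intro U C₀ α A h hA0 hα v hv hvpos hv2 hN ε hε hε1 y
  have hJ : ∀ w : EuclideanSpace ℝ (Fin 3), ⟪(α • rotGenL) w, w⟫ = 0 := fun w => by
    rw [_root_.FunLike.coe_smul, Pi.smul_apply, rotGenL_apply, real_inner_smul_left, inner_rotGen_self, mul_zero]
  have hJA : ‖(α • rotGenL)‖ ≤ A := by
    refine (ContinuousLinearMap.opNorm_le_bound _ (abs_nonneg α) fun x => ?_).trans hα
    rw [_root_.FunLike.coe_smul, Pi.smul_apply, rotGenL_apply, norm_smul, Real.norm_eq_abs]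
    exact mul_le_mul_of_nonneg_left (norm_rotGen_le x) (abs_nonneg _)
  have he : ‖(EuclideanSpace.single (0 : Fin 3) (1 : ℝ))‖ = 1 := by
    rw [EuclideanSpace.single, PiLp.norm_single, norm_one]
  exact ⟨upper_bound_rot h hJ hA0 hJA hv hvpos hv2 hN hε hε1 he y,
    lower_bound_rot h hJ hA0 hJA hv hvpos hN hε hε1 he y⟩

end Summit.NavierStokesRegularity.NavierStokesRegularity.Theorems
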